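import Mathlib.Analysis.Complex.Liouville
import Mathlib.Analysis.Calculus.DiffContOnCl
import Summits.QuantumFields.YangMills.Theorems.UnitScaleTiltProp8FlatPlaqCubicExpansion
import Summits.QuantumFields.YangMills.Theorems.UnitScaleTiltProp8FlatPlaqCubicGradient
import HarnessLib

/-!
# Route `UnitScaleTilt`, crux K1 child «MinimiserStabilityRegPr» (stmt-QuantumFields-19200), leaf V2′ `stub_halvingStep` — pillar P3b
# ([Balaban1985Variational] PROP. 4 AT BACKGROUND 1), PART 3: **THE SLOT DERIVATIVE OF THE PER-PLAQUETTE NON-QUADRATIC ACTION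
# `𝔣(Y) = 1 − ½tr(e^{Y₁}e^{Y₂}e^{Y₃}e^{Y₄}) + ½tr(ΣYᵢ) + ¼tr((ΣYᵢ)²)` IN `M₂(ℂ)`** — exact cubic part plus a Cauchy-estimated remainder
# (matrix analysis only; no lattice)

Cell `ym3-torus` (HUMAN RULING D-0037, YM ladder rung R3), width seat `ym-ust-19200-w5` gen 0 (OWNER ym3-torus-plan g24, W-SEAT MAP pass #2: «w5 = P3b»).
`--supports stmt-QuantumFields-19200 --as helper`; count-neutral.  YM₃ on T³ is a ladder rung (R3), not the Clay problem; nothing here is a claim about the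
crux, d = 4 or the mass gap.

THE OBJECT.  At background `1`, with `Y₁ = iηA(b₁)`, `Y₂ = iηA(b₂)`, `Y₃ = −iηA(b₃)`, `Y₄ = −iηA(b₄)` the four exponents of a plaquette, the per-plaquette
summand of the tree's `SU(2)` Wilson action in the exponential chart, MINUS its linear and quadratic Taylor parts, is (tr 1 = 2)
`𝔣(Y) := 1 − ½tr(e^{Y₁}e^{Y₂}e^{Y₃}e^{Y₄}) + ½tr(ΣYᵢ) + ¼tr((ΣYᵢ)²)` — print's `V₀(A,∂p)` of [Balaban1985Variational] (26)∕(30) at `U₀ = 1` (holomorphic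
in the `𝔤ᶜ`-valued exponents: «an entire function of A … for A in the space of all complex N × N matrices», p. 282).  By PART 1
(`FlatPlaqCubic.norm_exp4_sub_taylor3_le`, `trace_quad_eq`) `𝔣 = −½tr C(Y) − ½tr Rem(Y)` with the ordered cubic term `C` and `‖Rem‖ ≤ 44m⁴`.
THIS FILE proves the one-variable statement the gradient estimate (98) is assembled from (PART 4, on the lattice):
* `frak_rotate` — `𝔣(Y₂,Y₃,Y₄,Y₁) = 𝔣(Y₁,Y₂,Y₃,Y₄)` (cyclicity of the trace), so a derivative in ANY slot is a slot-one derivative of a rotation;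
* `frak_eq_cubic_rem` — the split `𝔣 = −½tr C − ½tr Rem` in `M₂(ℂ)`;
* `differentiable_frak_slot1`, and **`norm_deriv_frak_slot1_add_le`** — for `‖Yᵢ‖ ≤ m`, `0 < ρ`, `m + ρ‖H‖ ≤ 1`:
  `‖d/dt 𝔣(Y₁ + tH, Y₂, Y₃, Y₄)|₀ + ½tr(H·∇₁C(Y))‖ ≤ 44(m + ρ‖H‖)⁴/ρ` — the cubic part differentiated EXACTLY (PART 1b `hasDerivAt_trace_cubic_slot1`), the
  remainder by the CAUCHY ESTIMATE on the circle `|t| = ρ` (Mathlib `Complex.norm_deriv_le_of_forall_mem_sphere_norm_le`) from the function bound `|tr Rem| ≤ 88m′⁴`.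
HONEST SCOPE.  Elementary complex analysis in finite dimensions ([folklore]) serving the printed step (90)–(96); nothing of Bałaban's is asserted.  Sorry-free,
no definition, axioms standard.

References: T. Bałaban, CMP **102** (1985) 277–309 [Balaban1985Variational] (26)–(31) p.282, (90)–(98) pp.291–293.
-/

set_option autoImplicit false

noncomputable section

open scoped BigOperators Matrix.Norms.L2Operator
open NormedSpace

namespace Summit.QuantumFields.YangMills.Theorems.FlatPlaqDeriv

open Literature.MathematicalPhysics.QuantumFieldTheory.Balaban1983to89
open Summit.QuantumFields.YangMills.Theorems.FlatPlaqCubic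

/-! ## §1 Trace facts in `M₂(ℂ)` -/

/-- `|tr X| ≤ 2‖X‖` for a `2 × 2` matrix in the operator norm (tree: `MatrixNorms.norm_ntr_le_opNorm`). [folklore] -/
theorem norm_trace_le_two_mul (X : Matrix (Fin 2) (Fin 2) ℂ) : ‖Matrix.trace X‖ ≤ 2 * ‖X‖ := by
  have h := MatrixNorms.norm_ntr_le_opNorm X
  rw [MatrixNorms.ntr, Fintype.card_fin, norm_div, Nat.cast_ofNat, Complex.norm_ofNat] at h
  linarith [div_le_iff₀ (by norm_num : (0:ℝ) < 2) |>.mp h]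

/-- `|tr(H·X)| ≤ 2‖H‖‖X‖` in `M₂(ℂ)`. [folklore] -/
theorem norm_trace_mul_le (H X : Matrix (Fin 2) (Fin 2) ℂ) : ‖Matrix.trace (H * X)‖ ≤ 2 * ‖H‖ * ‖X‖ :=
  (norm_trace_le_two_mul _).trans (by rw [mul_assoc]; exact mul_le_mul_of_nonneg_left (norm_mul_le _ _) (by norm_num))

/-! ## §2 The per-plaquette function: rotation and the cubic∕remainder split -/

/-- **Cyclic invariance**: `𝔣(Y₂,Y₃,Y₄,Y₁) = 𝔣(Y₁,Y₂,Y₃,Y₄)` (the plaquette traced from its second corner). [cite: Balaban1985Variational, (24) p.282] -/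
theorem frak_rotate {n : Type*} [Fintype n] [DecidableEq n] (Y₁ Y₂ Y₃ Y₄ : Matrix n n ℂ) :
    (1 - (2 : ℂ)⁻¹ * Matrix.trace (exp Y₂ * exp Y₃ * exp Y₄ * exp Y₁) + (2 : ℂ)⁻¹ * Matrix.trace (Y₂ + Y₃ + Y₄ + Y₁) + (4 : ℂ)⁻¹ * Matrix.trace ((Y₂ + Y₃ + Y₄ + Y₁) ^ 2)) = (1 - (2 : ℂ)⁻¹ * Matrix.trace (exp Y₁ * exp Y₂ * exp Y₃ * exp Y₄) + (2 : ℂ)⁻¹ * Matrix.trace (Y₁ + Y₂ + Y₃ + Y₄) + (4 : ℂ)⁻¹ * Matrix.trace ((Y₁ + Y₂ + Y₃ + Y₄) ^ 2)) := by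
  have hprod : Matrix.trace (exp Y₂ * exp Y₃ * exp Y₄ * exp Y₁) = Matrix.trace (exp Y₁ * exp Y₂ * exp Y₃ * exp Y₄) := by
    rw [Matrix.trace_mul_comm, ← mul_assoc, ← mul_assoc]
  have hsum : Y₂ + Y₃ + Y₄ + Y₁ = Y₁ + Y₂ + Y₃ + Y₄ := by abel
  rw [hprod, hsum]

/-- **The split in `M₂(ℂ)`**: `𝔣(Y) = −½tr C(Y) − ½tr Rem(Y)`, `Rem = e^{Y₁}e^{Y₂}e^{Y₃}e^{Y₄} − (1 + ΣYᵢ + Q(Y) + C(Y))` (uses `tr 1 = 2` and `tr Q = ½tr(ΣYᵢ)²`).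
[cite: Balaban1985Variational, (26) p.282, (30) p.282] -/
theorem frak_eq_cubic_rem (Y₁ Y₂ Y₃ Y₄ : Matrix (Fin 2) (Fin 2) ℂ) :
    (1 - (2 : ℂ)⁻¹ * Matrix.trace (exp Y₁ * exp Y₂ * exp Y₃ * exp Y₄) + (2 : ℂ)⁻¹ * Matrix.trace (Y₁ + Y₂ + Y₃ + Y₄) + (4 : ℂ)⁻¹ * Matrix.trace ((Y₁ + Y₂ + Y₃ + Y₄) ^ 2)) =
      -((2 : ℂ)⁻¹ * Matrix.trace ((6 : ℂ)⁻¹ • (Y₁ ^ 3 + Y₂ ^ 3 + Y₃ ^ 3 + Y₄ ^ 3) + (2 : ℂ)⁻¹ • (Y₁ ^ 2 * Y₂ + Y₁ * Y₂ ^ 2 + Y₁ ^ 2 * Y₃ + Y₁ * Y₃ ^ 2 + Y₁ ^ 2 * Y₄ + Y₁ * Y₄ ^ 2 + Y₂ ^ 2 * Y₃ + Y₂ * Y₃ ^ 2 + Y₂ ^ 2 * Y₄ + Y₂ * Y₄ ^ 2 + Y₃ ^ 2 * Y₄ + Y₃ * Y₄ ^ 2) + (Y₁ * Y₂ * Y₃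 + Y₁ * Y₂ * Y₄ + Y₁ * Y₃ * Y₄ + Y₂ * Y₃ * Y₄)))
      - (2 : ℂ)⁻¹ * Matrix.trace (exp Y₁ * exp Y₂ * exp Y₃ * exp Y₄ - (1 + (Y₁ + Y₂ + Y₃ + Y₄) + ((2 : ℂ)⁻¹ • (Y₁ ^ 2 + Y₂ ^ 2 + Y₃ ^ 2 + Y₄ ^ 2) + (Y₁ * Y₂ + Y₁ * Y₃ + Y₁ * Y₄ + Y₂ * Y₃ + Y₂ * Y₄ + Y₃ * Y₄)) + ((6 : ℂ)⁻¹ • (Y₁ ^ 3 + Y₂ ^ 3 + Y₃ ^ 3 + Y₄ ^ 3) + (2 : ℂ)⁻¹ • (Y₁ ^ 2 * Y₂ + Y₁ * Y₂ ^ 2 + Y₁ ^ 2 * Y₃ + Y₁ * Y₃ ^ 2 + Y₁ ^ 2 * Y₄ + Y₁ * Y₄ ^ 2 + Y₂ ^ 2 * Y₃ + Y₂ * Y₃ ^ 2 + Y₂ ^ 2 * Y₄ + Y₂ * Y₄ ^ 2 + Y₃ ^ 2 * Y₄ + Y₃ * Y₄ ^ 2) + (Y₁ * Y₂ * Y₃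 + Y₁ * Y₂ * Y₄ + Y₁ * Y₃ * Y₄ + Y₂ * Y₃ * Y₄)))) := by
  have hq := trace_quad_eq Y₁ Y₂ Y₃ Y₄
  have h1 : Matrix.trace (1 : Matrix (Fin 2) (Fin 2) ℂ) = 2 := by simp
  simp only [Matrix.trace_sub, Matrix.trace_add, h1, hq]
  ring

/-! ## §3 The slot-one derivative: differentiability and the Cauchy bound on the remainder -/

section Slot

variable (Y₁ Y₂ Y₃ Y₄ H : Matrix (Fin 2) (Fin 2) ℂ)

/-- The affine line `t ↦ Y₁ + tH` is differentiable. [folklore] -/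
theorem differentiable_line : Differentiable ℂ (fun t : ℂ => Y₁ + t • H) :=
  (differentiable_const Y₁).add (differentiable_id.smul_const H)

/-- `t ↦ e^{Y₁ + tH}` is differentiable (the exponential is analytic on the Banach algebra `M₂(ℂ)`). [folklore] -/
theorem differentiable_exp_line : Differentiable ℂ (fun t : ℂ => exp (Y₁ + t • H)) :=
  fun t => ((NormedSpace.exp_analytic (𝕂 := ℂ) (Y₁ + t • H)).differentiableAt).comp t ((differentiable_line Y₁ H) t)

/-- The four-factor product along the slot-one line is differentiable. [folklore] -/
theorem differentiable_exp4_line : Differentiable ℂ (fun t : ℂ => exp (Y₁ + t • H) * exp Y₂ * exp Y₃ * exp Y₄) :=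
  (((differentiable_exp_line Y₁ H).mul (differentiable_const _)).mul (differentiable_const _)).mul (differentiable_const _)

/-- The traced Taylor polynomial `tr(1 + ΣYᵢ + Q + C)` along the slot-one line is differentiable (a polynomial in `t`). [folklore] -/
theorem differentiable_taylor3_line :
    Differentiable ℂ (fun t : ℂ => (1 + ((Y₁ + t • H) + Y₂ + Y₃ + Y₄) + ((2 : ℂ)⁻¹ • ((Y₁ + t • H) ^ 2 + Y₂ ^ 2 + Y₃ ^ 2 + Y₄ ^ 2) + ((Y₁ + t • H) * Y₂ + (Y₁ + t • H) * Y₃ + (Y₁ + t • H) * Y₄ + Y₂ * Y₃ + Y₂ * Y₄ + Y₃ * Y₄)) + ((6 : ℂ)⁻¹ • ((Y₁ + t • H) ^ 3 + Y₂ ^ 3 + Y₃ ^ 3 + Y₄ ^ 3) + (2 : ℂ)⁻¹ • ((Y₁ + t • H) ^ 2 * Y₂ + (Y₁ + t • H) * Y₂ ^ 2 + (Y₁ + t • H) ^ 2 * Y₃ + (Y₁ + t • H) * Y₃ ^ 2 + (Y₁ + t • H) ^ 2 * Y₄ + (Y₁ + t • H) * Y₄ ^ 2 + Y₂ ^ 2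 * Y₃ + Y₂ * Y₃ ^ 2 + Y₂ ^ 2 * Y₄ + Y₂ * Y₄ ^ 2 + Y₃ ^ 2 * Y₄ + Y₃ * Y₄ ^ 2) + ((Y₁ + t • H) * Y₂ * Y₃ + (Y₁ + t • H) * Y₂ * Y₄ + (Y₁ + t • H) * Y₃ * Y₄ + Y₂ * Y₃ * Y₄)))) := by
  fun_prop

/-- `𝔣` along the slot-one line is differentiable. [cite: Balaban1985Variational, p.282 («an entire function of A»)] -/
theorem differentiable_frak_slot1 : Differentiable ℂ (fun t : ℂ => (1 - (2 : ℂ)⁻¹ * Matrix.trace (exp (Y₁ + t • H) * exp Y₂ * exp Y₃ * exp Y₄) + (2 : ℂ)⁻¹ * Matrix.trace ((Y₁ + t • H) + Y₂ + Y₃ + Y₄) + (4 : ℂ)⁻¹ * Matrix.trace (((Y₁ + t • H) + Y₂ + Y₃ + Y₄) ^ 2))) := by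
  have hT : Differentiable ℂ (fun X : Matrix (Fin 2) (Fin 2) ℂ => Matrix.trace X) :=
    (LinearMap.toContinuousLinearMap (Matrix.traceLinearMap (Fin 2) ℂ ℂ)).differentiable
  have hL := differentiable_line Y₁ H
  have hE := differentiable_exp4_line Y₁ Y₂ Y₃ Y₄ H
  have hS : Differentiable ℂ (fun t : ℂ => Y₁ + t • H + Y₂ + Y₃ + Y₄) := ((hL.add_const Y₂).add_const Y₃).add_const Y₄
  exact (((differentiable_const _).sub ((hT.comp hE).const_mul _)).add ((hT.comp hS).const_mul _)).add ((hT.comp (hS.pow 2)).const_mul _)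

/-- **THE SLOT-ONE DERIVATIVE WITH THE CUBIC PART EXACT AND THE REMAINDER CAUCHY-ESTIMATED.**  For `‖Yᵢ‖ ≤ m`, `0 < ρ` and `m + ρ‖H‖ ≤ 1`:
`‖d/dt 𝔣(Y₁ + tH, Y₂, Y₃, Y₄)|₀ + ½tr(H·∇₁C(Y))‖ ≤ 44(m + ρ‖H‖)⁴/ρ` — on the circle `|t| = ρ` every exponent has norm `≤ m + ρ‖H‖ ≤ 1`, so the remainder's
trace is `≤ 2·44(m + ρ‖H‖)⁴` there, and Cauchy bounds its derivative at `0` by that over `ρ`. [cite: Balaban1985Variational, (90)-(98) pp.291-293] -/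
theorem norm_deriv_frak_slot1_add_le {m ρ : ℝ} (h1 : ‖Y₁‖ ≤ m) (h2 : ‖Y₂‖ ≤ m) (h3 : ‖Y₃‖ ≤ m) (h4 : ‖Y₄‖ ≤ m)
    (hρ : 0 < ρ) (hm1 : m + ρ * ‖H‖ ≤ 1) :
    ‖deriv (fun t : ℂ => (1 - (2 : ℂ)⁻¹ * Matrix.trace (exp (Y₁ + t • H) * exp Y₂ * exp Y₃ * exp Y₄) + (2 : ℂ)⁻¹ * Matrix.trace ((Y₁ + t • H) + Y₂ + Y₃ + Y₄) + (4 : ℂ)⁻¹ * Matrix.trace (((Y₁ + t • H) + Y₂ + Y₃ + Y₄) ^ 2))) 0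
        + (2 : ℂ)⁻¹ * Matrix.trace (H * ((2 : ℂ)⁻¹ • Y₁ ^ 2 + (2 : ℂ)⁻¹ • (Y₁ * Y₂ + Y₂ * Y₁ + Y₂ ^ 2 + Y₁ * Y₃ + Y₃ * Y₁ + Y₃ ^ 2 + Y₁ * Y₄ + Y₄ * Y₁ + Y₄ ^ 2) + (Y₂ * Y₃ + Y₂ * Y₄ + Y₃ * Y₄)))‖ ≤ 44 * (m + ρ * ‖H‖) ^ 4 / ρ := by
  have hm0 : 0 ≤ m := (norm_nonneg _).trans h1
  -- the traced remainder along the line and its Cauchy bound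
  set R : ℂ → ℂ := fun t => Matrix.trace (exp (Y₁ + t • H) * exp Y₂ * exp Y₃ * exp Y₄ - (1 + ((Y₁ + t • H) + Y₂ + Y₃ + Y₄) + ((2 : ℂ)⁻¹ • ((Y₁ + t • H) ^ 2 + Y₂ ^ 2 + Y₃ ^ 2 + Y₄ ^ 2) + ((Y₁ + t • H) * Y₂ + (Y₁ + t • H) * Y₃ + (Y₁ + t • H) * Y₄ + Y₂ * Y₃ + Y₂ * Y₄ + Y₃ * Y₄)) + ((6 : ℂ)⁻¹ • ((Y₁ + t • H) ^ 3 + Y₂ ^ 3 + Y₃ ^ 3 + Y₄ ^ 3) + (2 : ℂ)⁻¹ • ((Y₁ + t • H) ^ 2 * Y₂ + (Y₁ + t • H) * Y₂ ^ 2 + (Y₁ + t • H) ^ 2 * Y₃ + (Y₁ + t • H) * Y₃ ^ 2 + (Y₁ + t • H) ^ 2 * Y₄ + (Y₁ + t • H) * Y₄ ^ 2 + Y₂ ^ 2 * Y₃ + Y₂ * Y₃ ^ 2 + Y₂ ^ 2 * Y₄ + Y₂ * Y₄ ^ 2 + Y₃ ^ 2 * Y₄ + Y₃ * Y₄ ^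 2) + ((Y₁ + t • H) * Y₂ * Y₃ + (Y₁ + t • H) * Y₂ * Y₄ + (Y₁ + t • H) * Y₃ * Y₄ + Y₂ * Y₃ * Y₄)))) with hR
  have hT : Differentiable ℂ (fun X : Matrix (Fin 2) (Fin 2) ℂ => Matrix.trace X) :=
    (LinearMap.toContinuousLinearMap (Matrix.traceLinearMap (Fin 2) ℂ ℂ)).differentiable
  have hRd : Differentiable ℂ R := hT.comp ((differentiable_exp4_line Y₁ Y₂ Y₃ Y₄ H).sub (differentiable_taylor3_line Y₁ Y₂ Y₃ Y₄ H))
  have hRbound : ∀ z ∈ Metric.sphere (0 : ℂ) ρ, ‖R z‖ ≤ 2 * (44 * (m + ρ * ‖H‖) ^ 4) := by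
    intro z hz
    rw [mem_sphere_zero_iff_norm] at hz
    have hz1 : ‖Y₁ + z • H‖ ≤ m + ρ * ‖H‖ :=
      (norm_add_le _ _).trans (add_le_add h1 (by rw [norm_smul, hz]))
    have hρH : 0 ≤ ρ * ‖H‖ := mul_nonneg hρ.le (norm_nonneg _)
    have hrem := norm_exp4_sub_taylor3_le (Y₁ + z • H) Y₂ Y₃ Y₄ hz1 (h2.trans (by linarith)) (h3.trans (by linarith))
      (h4.trans (by linarith)) hm1
    exact (norm_trace_le_two_mul _).trans (by linarith)
  have hCauchy : ‖deriv R 0‖ ≤ 2 * (44 * (m + ρ * ‖H‖) ^ 4) / ρ :=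
    Complex.norm_deriv_le_of_forall_mem_sphere_norm_le hρ hRd.diffContOnCl hRbound
  -- the cubic part, exactly
  have hC := hasDerivAt_trace_cubic_slot1 Y₁ Y₂ Y₃ Y₄ H
  -- the split along the line
  have hsplit : (fun t : ℂ => (1 - (2 : ℂ)⁻¹ * Matrix.trace (exp (Y₁ + t • H) * exp Y₂ * exp Y₃ * exp Y₄) + (2 : ℂ)⁻¹ * Matrix.trace ((Y₁ + t • H) + Y₂ + Y₃ + Y₄) + (4 : ℂ)⁻¹ * Matrix.trace (((Y₁ + t • H) + Y₂ + Y₃ + Y₄) ^ 2))) =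
      fun t : ℂ => -((2 : ℂ)⁻¹ * Matrix.trace ((6 : ℂ)⁻¹ • ((Y₁ + t • H) ^ 3 + Y₂ ^ 3 + Y₃ ^ 3 + Y₄ ^ 3) + (2 : ℂ)⁻¹ • ((Y₁ + t • H) ^ 2 * Y₂ + (Y₁ + t • H) * Y₂ ^ 2 + (Y₁ + t • H) ^ 2 * Y₃ + (Y₁ + t • H) * Y₃ ^ 2 + (Y₁ + t • H) ^ 2 * Y₄ + (Y₁ + t • H) * Y₄ ^ 2 + Y₂ ^ 2 * Y₃ + Y₂ * Y₃ ^ 2 + Y₂ ^ 2 * Y₄ + Y₂ * Y₄ ^ 2 + Y₃ ^ 2 * Y₄ + Y₃ * Y₄ ^ 2) + ((Y₁ + t • H) * Y₂ * Y₃ + (Y₁ + t • H) * Y₂ * Y₄ + (Y₁ + t • H) * Y₃ * Y₄ + Y₂ * Y₃ * Y₄))) - (2 : ℂ)⁻¹ * R t := by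
    funext t; rw [hR]; exact frak_eq_cubic_rem (Y₁ + t • H) Y₂ Y₃ Y₄
  have hderiv : HasDerivAt (fun t : ℂ => (1 - (2 : ℂ)⁻¹ * Matrix.trace (exp (Y₁ + t • H) * exp Y₂ * exp Y₃ * exp Y₄) + (2 : ℂ)⁻¹ * Matrix.trace ((Y₁ + t • H) + Y₂ + Y₃ + Y₄) + (4 : ℂ)⁻¹ * Matrix.trace (((Y₁ + t • H) + Y₂ + Y₃ + Y₄) ^ 2)))
      (-((2 : ℂ)⁻¹ * Matrix.trace (H * ((2 : ℂ)⁻¹ • Y₁ ^ 2 + (2 : ℂ)⁻¹ • (Y₁ * Y₂ + Y₂ * Y₁ + Y₂ ^ 2 + Y₁ * Y₃ + Y₃ * Y₁ + Y₃ ^ 2 + Y₁ * Y₄ + Y₄ * Y₁ + Y₄ ^ 2) + (Y₂ * Y₃ + Y₂ * Y₄ + Y₃ * Y₄)))) - (2 : ℂ)⁻¹ * deriv R 0) 0 := by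
    rw [hsplit]
    exact (hC.const_mul _).neg.sub ((hRd 0).hasDerivAt.const_mul _)
  rw [hderiv.deriv]
  have e : -((2 : ℂ)⁻¹ * Matrix.trace (H * ((2 : ℂ)⁻¹ • Y₁ ^ 2 + (2 : ℂ)⁻¹ • (Y₁ * Y₂ + Y₂ * Y₁ + Y₂ ^ 2 + Y₁ * Y₃ + Y₃ * Y₁ + Y₃ ^ 2 + Y₁ * Y₄ + Y₄ * Y₁ + Y₄ ^ 2) + (Y₂ * Y₃ + Y₂ * Y₄ + Y₃ * Y₄)))) - (2 : ℂ)⁻¹ * deriv R 0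
      + (2 : ℂ)⁻¹ * Matrix.trace (H * ((2 : ℂ)⁻¹ • Y₁ ^ 2 + (2 : ℂ)⁻¹ • (Y₁ * Y₂ + Y₂ * Y₁ + Y₂ ^ 2 + Y₁ * Y₃ + Y₃ * Y₁ + Y₃ ^ 2 + Y₁ * Y₄ + Y₄ * Y₁ + Y₄ ^ 2) + (Y₂ * Y₃ + Y₂ * Y₄ + Y₃ * Y₄))) = -((2 : ℂ)⁻¹ * deriv R 0) := by ring
  rw [e, norm_neg, norm_mul, norm_inv, Complex.norm_ofNat]
  have : (2 : ℝ)⁻¹ * ‖deriv R 0‖ ≤ (2 : ℝ)⁻¹ * (2 * (44 * (m + ρ * ‖H‖) ^ 4) / ρ) := mul_le_mul_of_nonneg_left hCauchy (by norm_num)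
  calc (2 : ℝ)⁻¹ * ‖deriv R 0‖ ≤ (2 : ℝ)⁻¹ * (2 * (44 * (m + ρ * ‖H‖) ^ 4) / ρ) := this
    _ = 44 * (m + ρ * ‖H‖) ^ 4 / ρ := by ring

end Slot

end Summit.QuantumFields.YangMills.Theorems.FlatPlaqDeriv

end
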